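import Literature.MathematicalPhysics.QuantumFieldTheory.Balaban1983to89.B9B8KnitTorusGlobPackaging

/-!
# `Balaban1983to89.B9B8KnitClosenessOfSectors` — the (B)-line bond junction, file 5: THE HERMITIAN JUNCTION CLOSENESS
# `|Δ_a(U)a − (c_fη)²·(Δ_knit a♯)♭|₍₋₃₎ ≤ ε|a|₍₋₁₎` DECOMPOSED INTO ITS FOUR SECTORS — `D*D` EXACT (file 1), LANDAU EXACT (file 4, at `M_N(ℂ)`),
# the two CURVATURE letters small (def-Y's displayed; the knit's by dag-n06-b's `curvAtInAk_opsAllZdPer`), and the AVERAGING CLOSENESS (c′) displayed as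
# ONE inequality between def-Y's `Q*(U)aQ(U)` and the knit's `QQZdP` — then fed to file 8b: the socket `SockB9P3Per` at the torus datum modulo (c′) + def-Y inputs

statement-level skeleton of published theorems with citation tags; proofs where landed; nothing here is a claim about the
Yang–Mills mass gap

Sub-row G-B8-T2S (unit `lit-balaban-t2s-1`, gen 7), lit-balaban RULING #10 road (a)–(e).  The junction closeness of files 7c′ ∕ 8b compares, on Hermitian
box fields `a` of a constant-level member, def-Y's `Δ_a(U) = Δ(U) + D_U R(U) D*_U + Q*(U)aQ(U)` ([4] (3.26), `U = bgY i U₀`) with `(c_fη)²` times the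
descent of the torus record's `Δ_knit = D*D + Δ′ + D R^per D* + Q*aQ` (`deltaAOf` of dag-n06-b's `opsAllZdPer` at the torus datum) applied to the lift `a♯`.
Sector by sector: (i) `D*D`: def-Y's `D*_U𝒦… ` no — def-Y's Hessian is `Δ(U) = coCurlY∘jordanY∘curlY + curv2Y` and its `coCurlY∘curlY` part IS `(c_fη)²·J(a♯)♭`
(file 1 `coCurlY_curlY_apply`), EXACT; (ii) CURVATURE: def-Y's `coCurlY∘(jordanY − 1)∘curlY + curv2Y` is DISPLAYED small (`κ`, r05's B-LINE 2 shape), the knit's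
`Δ′ = DpZd` is small by dag-n06-b's `curvAtInAk_opsAllZdPer` (constant `14d·M·α₀`, [4] (3.69)), transported to def-Y's currency here; (iii) LANDAU: EXACT on
Hermitian fields at `𝔸 = M_N(ℂ)`, `τ = tr`, `parS = parKnitY`, `G′ = GpY parKnitY` — file 4's `projRPer_eq_liftL_RY` ([4] (3.21) = (3.25) on the torus) composed
with file 2's `liftL_divY` and J-A's `covDerivFwd_liftY`; displayed as an identity in the fibre-generic theorem; (iv) AVERAGING: DISPLAYED as the single
inequality `|Q*(U)aQ(U)a − (c_fη)²·(QQZdP a♯)♭|₍₋₃₎ ≤ ε_Q|a|₍₋₁₎` — the remaining crux (c′) of the sub-row ([4] (3.16) with [5]'s linearised averaging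
`Q_j(U)` versus def-Y's one-shot transported average).  Total: `ε = κ + 14d·M·α₀ + ε_Q`.
Print: [4] (3.10) p. 392, (3.16) p. 393, (3.21)–(3.27) pp. 394–395, (3.69) p. 404, Thm 3.3 p. 399; [B8] (1.55)–(1.59) p. 86, Prop. 3 p. 87, p. 77 («Ω_j = T_η»).

WHAT IS PROVED (kernel, 0 sorry, theorems only; no `def`, no `… : Prop` fact, no `instance`, no `notation`).
* §1 bookkeeping: `wNormBY_neg`, `isSelfAdjoint_liftBd`, `isSelfAdjoint_covDivB_unitary`, `norm_descBd_le_of_forall`.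
* §2 sector identities at a constant-level member (`U = bgY i U₀`, `U₀` periodic): ★ `smul_descBd_Jcur_eq` (`(c_fη)²·J(a♯)♭ = coCurlY U (curlY U a)`),
  ★ `descBd_covDerivFwd_liftL` (`(D_{U₀}(Φ♯))♭ = (c_fη)⁻¹·D_UΦ`), ★ `covDivB_liftBd_eq_liftL` (`D*_{U₀}(a♯) = ((c_fη)⁻¹·D*_Ua)♯`),
  ★★ `wNormBY_smul_descBd_DpZd_le` (the knit's `Δ′` in def-Y currency: `|(c_fη)²·(Δ′a♯)♭|₍₋₃₎ ≤ 14d·M·α₀·|a|₍₋₁₎`, dag-n06-b BY NAME),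
  ★★ `landau_sector_exact` (at `M_N(ℂ)`: `(c_fη)²·(D R^per D* a♯)♭ = D_U R(U) D*_U a` for Hermitian `a`).
* §3 ★★★ `closeness_herm_of_sectors` (fibre-generic; Landau identity displayed) and ★★★ `closeness_herm_matrix` (at `M_N(ℂ)`, Landau discharged):
  the Hermitian junction closeness with `ε = κ + 14d·M·α₀ + ε_Q`.
* §4 ★★★ `sockB9P3Per_torusIdx_of_sectors` — file 8b's socket at the torus datum with the per-background binder now reading: `IsUnit Δ_a(U)` + three
  (3.47)₋₃ members at `B₀` + `IsUnit Δ′_a(U)`, `IsUnit (Q′G′²Q′*)(U)` + unitary knit legs + def-Y curvature smallness `κ` + averaging closeness `ε_Q`,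
  under `2(κ + 14d·M·a_T + ε_Q)B₀ ≤ 1` (the Hölder binder stays an input, as in file 8b).

HONEST SCOPE.  Sector bookkeeping; the averaging closeness (c′), def-Y's curvature smallness and def-Y's Thm-3.3 ∕ 3.11 inputs stay DISPLAYED; no estimate of
[4] ∕ [B8] is proved here beyond the transport of dag-n06-b's (3.69) bound; `SockB9P3Per` inhabited only modulo the displayed binder; `stub_PV3A` ∕ `B9P3PerAt`
NOT discharged; count-neutral; nothing continuum ∕ ℝ⁴ ∕ OS ∕ mass gap ∕ Clay — the Yang–Mills mass gap is NOT proved by any of this.  NEW file; files 1, 2, 4,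
7c′, 8b of this seat and dag-n06-b's `curvAtInAk_opsAllZdPer` are used BY NAME, nothing landed is modified.
-/

noncomputable section

namespace Literature.MathematicalPhysics.QuantumFieldTheory.Balaban1983to89.B9B8KnitClosenessOfSectors

open scoped BigOperators
open Node00
open B7Prop1Explicit renaming Site → LSite
open B7Prop1Explicit (e)
open B7Prop2Explicit (unitaryUnits)
open B6KLevelCensusIndexV1 (KIdx)
open B6GlobalChartV1 (PV boxEquiv)
open B8ScaledSupNorm (weight msup bondNorm Bdd)
open B8Ineq132 (covDerivFwd covDeriv InAk BondTouches)
open B8Eq140Level (SideTouches)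
open B8Eq138LandauZd (covLap covDivB)
open B8Eq155JBound (Jcur)
open B12Ineq417Flat (shiftCfg)
open B10Eq27TorusAxialLog (transl rel transl_rel)
open B8LeafModelZd (ZdIdx)
open B8LeafModelZd3SockPer (SockB9P3Per)
open B8Thm4TorusAt (torusLam)
open B8Thm2TorusMember (TorusMember torusIdx torusLamb)
open B8Ineq159AtLettersY (wNormBY_nonneg wNormBY_le_of_weight_mul_norm_le weight_mul_norm_le_wNormBY wNormBY_add_add_le)
open B8Eq158AtLettersY (deltaAY_apply)
open B9B8KnitBondTransfer (descBd liftBd descBd_apply liftBd_apply coCurlY_curlY_apply)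
open B9B8KnitNormsTransfer (weight_level_pos norm_liftBd_le msup_le_weight_top_mul bdd_of_forall_norm_le weight_defY_eq_mul_weight_knit)
open B9B8KnitNeumannCore (wNormBY_eq_weight_mul_norm)
open B9B8KnitLandauProjection (shiftCfg_eq_of_isPeriodic liftL_isPeriodic projRPer_eq_liftL_RY)
open B9B8KnitLandauTransfer (liftL_divY)
open B9B8KnitLetterTransfer (liftL liftL_eq liftL_apply descL descL_liftL)
open B9B8CarrierDictionary (liftFun liftCfg covDerivFwd_liftY)
open B9B8AveragingJunction (parKnitY)
open B8Thm2TorusLettersPerOfKnit (bgY liftCfg_bgY bgY_mem)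
open Node00.OpsYNablaBridge (chartY chartY_eq gradY_apply_eq_cdS)
open B9SupplySockB9P3ZdLetters (OpsZd deltaAOf)
open B9SupplySockB9P3ZdLettersOmega (OnDom)
open B9SupplySockB9P3ZdPer (curvAtInAk_opsAllZdPer)
open B9SupplySockB9P3ZdAllLettersZdPer (opsAllZdPer)
open B9Eq316AveragingTransposeZd (qQ betaTau)
open B9Eq316AveragingTransposeZdPrinted (QQZdP)
open B9Eq369CurvSmallZd (DpZd)
open B9Eq321LandauProjectionZd (star_covDeriv)
open B9Eq321LandauProjectionZdPer (projRPer)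
open B9Eq327GreenZdHermPer (bondTouches_univ)
open B9B8KnitTorusGlobPackaging (sockB9P3Per_torusIdx_of_defY)
open T4TermwiseTorus (IsPeriodic)

variable {d ℓ : ℕ} {hd : 1 ≤ d + 1} {hL : Odd (ℓ + 1) ∧ 1 < ℓ + 1} {b₀ b₁ : ℝ}

/-! ## §1 Bookkeeping -/

section Bookkeeping

variable {𝔸 : Type} [CStarAlgebra 𝔸] (i : KIdx d ℓ hd hL b₀ b₁) {n : ℕ}

/-- `|−Ψ|₍α₎ = |Ψ|₍α₎`. [cite: Balaban1985BackgroundPropagators, (3.41) p.397, bookkeeping] -/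
theorem wNormBY_neg (α : ℝ) (Ψ : FBondY i → 𝔸) : wNormBY i α (-Ψ) = wNormBY i α Ψ := by
  unfold wNormBY msup
  simp only [Pi.neg_apply, norm_neg]

omit [CStarAlgebra 𝔸] in
/-- the periodic lift of a Hermitian box field is Hermitian-valued. [cite: Balaban1985BackgroundPropagators, p.391 («𝔤-valued»), bookkeeping] -/
theorem isSelfAdjoint_liftBd [Star 𝔸] {a : FBondY i → 𝔸} (ha : ∀ b, IsSelfAdjoint (a b)) (z : LSite (d + 1)) (κ : Fin (d + 1)) :
    IsSelfAdjoint (liftBd i a z κ) := by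
  rw [liftBd_apply]; exact ha _

omit hd hL b₀ b₁ i in
/-- `D^{η*}_{U₀}A` of a Hermitian bond field at a unitary background is Hermitian (dag-n06's `star_covDeriv` summed).
[cite: Balaban1985BackgroundPropagators, p.391 («hermitian»), (3.8) p.392] -/
theorem isSelfAdjoint_covDivB_unitary (η : ℝ) {U₀ : LSite (d + 1) → Fin (d + 1) → 𝔸ˣ} (hU : ∀ x κ, U₀ x κ ∈ unitaryUnits 𝔸)
    {A : LSite (d + 1) → Fin (d + 1) → 𝔸} (hA : ∀ y μ, IsSelfAdjoint (A y μ)) (x : LSite (d + 1)) : IsSelfAdjoint (covDivB η U₀ A x) := by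
  unfold covDivB IsSelfAdjoint
  rw [star_sum]
  refine Finset.sum_congr rfl fun μ _ => ?_
  rw [star_covDeriv η hU]
  congr 1
  funext z
  exact (hA z μ).star_eq

omit [CStarAlgebra 𝔸] in
/-- the descent is bounded by any uniform bound of the knit field. [cite: Balaban1985RegularSpaces, p.77 («Ω_j = T_η»), bookkeeping] -/
theorem norm_descBd_le_of_forall [NormedRing 𝔸] {A : LSite (d + 1) → Fin (d + 1) → 𝔸} {c : ℝ} (hc : 0 ≤ c) (h : ∀ x μ, ‖A x μ‖ ≤ c) :
    ‖descBd i A‖ ≤ c :=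
  (pi_norm_le_iff_of_nonneg hc).2 fun b => by rw [descBd_apply]; exact h _ _

end Bookkeeping

/-! ## §2 The four sectors at a constant-level member -/

section Sectors

variable {𝔸 : Type} [CStarAlgebra 𝔸] (i : KIdx d ℓ hd hL b₀ b₁) {n : ℕ}

/-- ★ **THE `D*D` SECTOR IS EXACT**: `(c_fη)²·(J(a♯))♭ = coCurlY U (curlY U a)` at `U = bgY i U₀`, `U₀` periodic (file 1 `coCurlY_curlY_apply` read as an
identity of box fields). [cite: Balaban1985RegularSpaces, (1.55), (1.58) p.86; Balaban1985BackgroundPropagators, (3.9)–(3.10) p.392, (3.26) p.395] -/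
theorem smul_descBd_Jcur_eq {η : ℝ} (hη : η ≠ 0) {U₀ : LSite (d + 1) → Fin (d + 1) → 𝔸ˣ}
    (hU₀ : ∀ μ : Fin (d + 1), shiftCfg ((((PV d ℓ i.m i.K hd hL).sitesPerDir 0 : ℕ) : ℤ) • e μ) U₀ = U₀) (a : FBondY i → 𝔸) :
    ((i.cf * η) ^ 2 : ℝ) • descBd i (fun x μ => Jcur η U₀ (liftBd i a) μ x) = coCurlY i (bgY i U₀) (curlY i (bgY i U₀) a) := by
  funext b
  rw [Pi.smul_apply, descBd_apply, coCurlY_curlY_apply i η hη, liftCfg_bgY i hU₀, ← Complex.coe_smul, Complex.ofReal_pow]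

/-- ★ **THE KNIT's COVARIANT DERIVATIVE OF A LIFTED SITE FUNCTION, DESCENDED**: `(D^η_{U₀}(Φ♯))♭ = (c_fη)⁻¹·(D_UΦ)` (J-A `covDerivFwd_liftY` + def-Y
`gradY_apply_eq_cdS`). [cite: Balaban1985BackgroundPropagators, (3.3) pp.390–391; Balaban1985RegularSpaces, (1.1) p.76] -/
theorem descBd_covDerivFwd_liftL {η : ℝ} (hη : η ≠ 0) (hcf0 : i.cf ≠ 0) {U₀ : LSite (d + 1) → Fin (d + 1) → 𝔸ˣ}
    (hU₀ : ∀ μ : Fin (d + 1), shiftCfg ((((PV d ℓ i.m i.K hd hL).sitesPerDir 0 : ℕ) : ℤ) • e μ) U₀ = U₀) (Φ : SiteY i → 𝔸) :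
    descBd i (fun x μ => covDerivFwd η U₀ μ (liftL i Φ) x) = ((i.cf * η)⁻¹ : ℝ) • gradY i (bgY i U₀) Φ := by
  funext b
  rw [descBd_apply, Pi.smul_apply]
  conv_lhs => rw [← liftCfg_bgY i hU₀, liftL_eq, covDerivFwd_liftY, transl_rel]
  rw [gradY_apply_eq_cdS, chartY_eq, ← Complex.coe_smul, ← Complex.coe_smul, smul_smul]
  have hc : ((i.cf : ℝ) : ℂ) ≠ 0 := Complex.ofReal_ne_zero.2 hcf0
  have hη' : ((η : ℝ) : ℂ) ≠ 0 := Complex.ofReal_ne_zero.2 hη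
  congr 1
  rw [Complex.ofReal_inv, Complex.ofReal_inv, Complex.ofReal_mul]
  field_simp

/-- ★ **THE KNIT's DIVERGENCE OF THE LIFT IS THE LIFT OF def-Y's DIVERGENCE** (file 2 `liftL_divY` inverted): `D^{η*}_{U₀}(a♯) = ((c_fη)⁻¹·D*_Ua)♯`.
[cite: Balaban1985BackgroundPropagators, (3.8) p.392; Balaban1985RegularSpaces, (1.1) p.76, (1.38) p.82] -/
theorem covDivB_liftBd_eq_liftL {η : ℝ} (hη : η ≠ 0) (hcf0 : i.cf ≠ 0) {U₀ : LSite (d + 1) → Fin (d + 1) → 𝔸ˣ}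
    (hU₀ : ∀ μ : Fin (d + 1), shiftCfg ((((PV d ℓ i.m i.K hd hL).sitesPerDir 0 : ℕ) : ℤ) • e μ) U₀ = U₀) (a : FBondY i → 𝔸) :
    covDivB η U₀ (liftBd i a) = liftL i ((((i.cf * η : ℝ)) : ℂ)⁻¹ • divY i (bgY i U₀) a) := by
  funext x
  have h := congrFun (liftL_divY i η (bgY i U₀) hη a) x
  rw [liftCfg_bgY i hU₀] at h
  have hc : (((i.cf * η : ℝ)) : ℂ) ≠ 0 := Complex.ofReal_ne_zero.2 (mul_ne_zero hcf0 hη)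
  rw [liftL_apply] at h
  rw [liftL_apply, Pi.smul_apply, h, smul_smul, inv_mul_cancel₀ hc, one_smul]

variable [Nontrivial 𝔸] [FiniteDimensional ℝ 𝔸]

/-- ★★ **THE KNIT's CURVATURE LETTER `Δ′` IN def-Y's CURRENCY**: at a constant-level member (`levY ≡ n`, `c_f = L^{n+1}`), for a unitary `U₀ ∈ 𝔄_n(ℤ^{d+1}, α₀)`,
`α₀ > 0`, `M ≥ 1`: `|(c_fη)²·(Δ′(U₀)a♯)♭|₍₋₃₎ ≤ 14d·M·α₀·|a|₍₋₁₎` — dag-n06-b's `curvAtInAk_opsAllZdPer` ([4] (3.69), constant `14(d+1−1)`) read at the top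
level of the torus datum and transported through files 3's unit dictionary (`(c_fη)²·(c_fη)⁻³·(c_fη) = 1`).
[cite: Balaban1985BackgroundPropagators, (3.69) p.404, (3.10) p.392; Balaban1985RegularSpaces, (1.7) p.77, (1.59) p.86] -/
theorem wNormBY_smul_descBd_DpZd_le (τ : 𝔸 →ₗ[ℂ] ℂ) (hL1 : 1 ≤ ℓ + 1) (hlev : ∀ z : SiteY i, levY i z = n) (hcf : i.cf = (((ℓ + 1 : ℕ) : ℝ)) ^ (n + 1))
    {η : ℝ} (hη : 0 < η) {k : ℕ} (hk : 1 ≤ k) (ops₀ : ℝ → ZdIdx (d + 1) (ℓ + 1) → ℕ → OpsZd (d + 1) 𝔸) {M : ℝ} (hM : 1 ≤ M)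
    {U₀ : LSite (d + 1) → Fin (d + 1) → 𝔸ˣ} (hU₀ : ∀ x κ, U₀ x κ ∈ unitaryUnits 𝔸) {α₀ : ℝ} (hα : 0 < α₀)
    (hIn : InAk (ℓ + 1) n η α₀ (fun _ => (Set.univ : Set (LSite (d + 1)))) U₀) (a : FBondY i → 𝔸) :
    wNormBY i (-3) (((i.cf * η) ^ 2 : ℝ) • descBd i (DpZd η U₀ (liftBd i a))) ≤ 14 * d * M * α₀ * wNormBY i (-1) a := by
  set P₀ := (PV d ℓ i.m i.K hd hL).sitesPerDir 0 with hP₀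
  set t : TorusMember := ⟨η, hη, k, hk⟩ with ht
  have hLpos : (0 : ℝ) < ((ℓ + 1 : ℕ) : ℝ) := by positivity
  have hcf0 : 0 < i.cf := by rw [hcf]; exact pow_pos hLpos _
  have hx : 0 < i.cf * η := mul_pos hcf0 hη
  set cr : ℝ := (i.cf * η) ^ 2 with hcr
  have hcr0 : 0 < cr := pow_pos hx 2
  -- dag-n06-b's (3.69) bound for the torus record, at the top level `n` of the torus datum
  have hC := curvAtInAk_opsAllZdPer (ℓ + 1) τ P₀ hL1 (fun m => torusLamb (d := d + 1) m) ops₀ hM (torusIdx (d := d + 1) hL1 t) n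
  have hbd : ∀ b : LSite (d + 1) × Fin (d + 1), ‖liftBd i a b.1 b.2‖ ≤ ‖a‖ := fun b => norm_liftBd_le i (fun x => norm_le_pi_norm a x) b.1 b.2
  have hOn : OnDom (ℓ + 1) n η (torusIdx (d := d + 1) hL1 t).Ω (liftBd i a) :=
    ⟨fun y τ' h => absurd (bondTouches_univ y τ') h, bdd_of_forall_norm_le hL1 hη (by norm_num) hbd⟩
  set k₁ := weight (ℓ + 1) η (-1) n with hk₁
  set k₃ := weight (ℓ + 1) η (-3) n with hk₃
  have hk₁p : 0 < k₁ := B8ScaledSupNorm.weight_pos hL1 hη _ n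
  have hk₃p : 0 < k₃ := B8ScaledSupNorm.weight_pos hL1 hη _ n
  have hmsup : msup (ℓ + 1) n η (-(1 : ℝ)) (fun j (b : LSite (d + 1) × Fin (d + 1)) => SideTouches ((torusIdx (d := d + 1) hL1 t).Ω j) b.1 b.2)
      (fun b => liftBd i a b.1 b.2) ≤ k₁ * ‖a‖ := msup_le_weight_top_mul hL1 hη (by norm_num) (norm_nonneg a) hbd
  have hk₃eq : ((((ℓ + 1 : ℕ) : ℝ)) ^ n * η) ^ 3 = k₃ := by
    rw [hk₃, show (-3 : ℝ) = -((3 : ℕ) : ℝ) by norm_num, B8ScaledSupNorm.weight_neg_natCast]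
  -- pointwise bound of the knit letter on the lift
  have hpt : ∀ (x : LSite (d + 1)) (μ : Fin (d + 1)), ‖DpZd η U₀ (liftBd i a) x μ‖ ≤ k₃⁻¹ * (14 * d * M * α₀ * (k₁ * ‖a‖)) := by
    intro x μ
    have h : ((((ℓ + 1 : ℕ) : ℝ)) ^ n * η) ^ 3 * ‖DpZd η U₀ (liftBd i a) x μ‖ ≤
        14 * ((d + 1 - 1 : ℕ) : ℝ) * M * α₀ * msup (ℓ + 1) n η (-(1 : ℝ))
          (fun j (b : LSite (d + 1) × Fin (d + 1)) => SideTouches ((torusIdx (d := d + 1) hL1 t).Ω j) b.1 b.2) (fun b => liftBd i a b.1 b.2) :=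
      hC α₀ U₀ hU₀ hα hIn (liftBd i a) hOn n le_rfl x μ (bondTouches_univ x μ)
    have hd' : ((d + 1 - 1 : ℕ) : ℝ) = d := by simp
    rw [hd', hk₃eq] at h
    rw [← div_eq_inv_mul, le_div_iff₀' hk₃p]
    refine h.trans ?_
    exact mul_le_mul_of_nonneg_left hmsup (by positivity)
  -- transport to def-Y currency
  have hr₃ : (i.cf * η) ^ (-3 : ℝ) = ((i.cf * η) ^ 3)⁻¹ := by
    rw [show (-3 : ℝ) = -((3 : ℕ) : ℝ) by norm_num, Real.rpow_neg hx.le, Real.rpow_natCast]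
  have hr₁ : (i.cf * η) ^ (-1 : ℝ) = (i.cf * η)⁻¹ := by
    rw [show (-1 : ℝ) = -((1 : ℕ) : ℝ) by norm_num, Real.rpow_neg hx.le, Real.rpow_natCast, pow_one]
  have hw₃ : weight (ℓ + 1) |i.cf|⁻¹ (-3) n = ((i.cf * η) ^ 3)⁻¹ * k₃ := by
    rw [weight_defY_eq_mul_weight_knit i hcf hη, hr₃]
  have hw₁ : weight (ℓ + 1) |i.cf|⁻¹ (-1) n = (i.cf * η)⁻¹ * k₁ := by
    rw [weight_defY_eq_mul_weight_knit i hcf hη, hr₁]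
  have hsup : ‖descBd i (DpZd η U₀ (liftBd i a))‖ ≤ k₃⁻¹ * (14 * d * M * α₀ * (k₁ * ‖a‖)) :=
    norm_descBd_le_of_forall i (by positivity) hpt
  rw [wNormBY_eq_weight_mul_norm i hlev, wNormBY_eq_weight_mul_norm i hlev, hw₃, hw₁, norm_smul, Real.norm_eq_abs, abs_of_pos hcr0, hcr]
  have hk₃ne : k₃ ≠ 0 := hk₃p.ne'
  have hxne : i.cf * η ≠ 0 := hx.ne'
  calc ((i.cf * η) ^ 3)⁻¹ * k₃ * ((i.cf * η) ^ 2 * ‖descBd i (DpZd η U₀ (liftBd i a))‖)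
      ≤ ((i.cf * η) ^ 3)⁻¹ * k₃ * ((i.cf * η) ^ 2 * (k₃⁻¹ * (14 * d * M * α₀ * (k₁ * ‖a‖)))) :=
        mul_le_mul_of_nonneg_left (mul_le_mul_of_nonneg_left hsup (by positivity)) (by positivity)
    _ = 14 * d * M * α₀ * ((i.cf * η)⁻¹ * k₁ * ‖a‖) := by field_simp

end Sectors

/-! ## §2′ The Landau sector at the matrix fibre -/

section LandauMatrix

open scoped Matrix Matrix.Norms.L2Operator

variable {N : ℕ} [NeZero N] (i : KIdx d ℓ hd hL b₀ b₁) {n : ℕ}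

omit [NeZero N] in
/-- ★★ **THE LANDAU SECTOR IS EXACT ON HERMITIAN FIELDS** at `𝔸 = M_N(ℂ)`, `τ = tr`, def-Y's letters at the knit's transporters (`parS = parKnitY`,
`G′ = GpY parKnitY`), in the regime `Δ′_a(U)`, `Q′G′²Q′*(U)` invertible, for a `G`-valued (`G ≤ U(N)`) periodic `U₀` with `G`-valued knit legs:
`(c_fη)²·(D^η_{U₀} R^per(U₀) D^{η*}_{U₀} a♯)♭ = D_U R(U) D*_U a` for every Hermitian box field `a` — file 4's `projRPer_eq_liftL_RY` ([4] (3.21) = (3.25)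
on the torus) at `f = D^{η*}_{U₀}a♯ = ((c_fη)⁻¹D*_Ua)♯` (Hermitian, periodic), then §2's derivative transfer.
[cite: Balaban1985BackgroundPropagators, (3.21)–(3.25) pp.394–395, (3.26) p.395, p.391; Balaban1985RegularSpaces, (1.58) p.86, p.77 («Ω_j = T_η»)] -/
theorem landau_sector_exact (hlev : ∀ z : SiteY i, levY i z = n) (hcf : i.cf = (((ℓ + 1 : ℕ) : ℝ)) ^ (n + 1))
    {G : Subgroup (Matrix (Fin N) (Fin N) ℂ)ˣ} (hG : G ≤ B7Prop2Explicit.unitaryUnits (Matrix (Fin N) (Fin N) ℂ))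
    {U₀ : LSite (d + 1) → Fin (d + 1) → (Matrix (Fin N) (Fin N) ℂ)ˣ} (hU₀G : ∀ x μ, U₀ x μ ∈ G)
    (hU₀per : IsPeriodic ((PV d ℓ i.m i.K hd hL).sitesPerDir 0) U₀)
    (hpar : ∀ z w : SiteY i, parKnitY i (bgY i U₀) z w ∈ G)
    (hΔ : IsUnit (deltaPrimeAY i (parKnitY i) (bgY i U₀))) (hX : IsUnit (XY i (parKnitY i) (GpY i (parKnitY i)) (bgY i U₀)))
    {η : ℝ} (hη : η ≠ 0) (τ : Matrix (Fin N) (Fin N) ℂ →ₗ[ℂ] ℂ) (hτ : ∀ a, τ a = Matrix.trace a)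
    {a : FBondY i → Matrix (Fin N) (Fin N) ℂ} (ha : ∀ b, IsSelfAdjoint (a b)) :
    letI : CStarAlgebra (Matrix (Fin N) (Fin N) ℂ) := {}
    ((i.cf * η) ^ 2 : ℝ) • descBd i (fun x μ => covDerivFwd η U₀ μ
        (projRPer τ ((PV d ℓ i.m i.K hd hL).sitesPerDir 0) (ℓ + 1) n η (torusLam (d := d + 1) n) U₀ (covDivB η U₀ (liftBd i a))) x) =
      gradY i (bgY i U₀) (RY i (parKnitY i) (GpY i (parKnitY i)) (bgY i U₀) (divY i (bgY i U₀) a)) := by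
  letI : CStarAlgebra (Matrix (Fin N) (Fin N) ℂ) := {}
  have hLpos : (0 : ℝ) < ((ℓ + 1 : ℕ) : ℝ) := by positivity
  have hcf0 : i.cf ≠ 0 := by rw [hcf]; exact (pow_pos hLpos _).ne'
  have hU₀sh : ∀ μ : Fin (d + 1), shiftCfg ((((PV d ℓ i.m i.K hd hL).sitesPerDir 0 : ℕ) : ℤ) • e μ) U₀ = U₀ :=
    fun μ => shiftCfg_eq_of_isPeriodic hU₀per μ
  have hU₀u : ∀ x κ, U₀ x κ ∈ unitaryUnits (Matrix (Fin N) (Fin N) ℂ) := fun x κ => hG (hU₀G x κ)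
  set U := bgY i U₀ with hU
  set f₁ : SiteY i → Matrix (Fin N) (Fin N) ℂ := (((i.cf * η : ℝ)) : ℂ)⁻¹ • divY i U a with hf₁
  have h3 : covDivB η U₀ (liftBd i a) = liftL i f₁ := covDivB_liftBd_eq_liftL i hη hcf0 hU₀sh a
  have hfh : ∀ x, IsSelfAdjoint (liftL i f₁ x) := fun x => by
    rw [← congrFun h3 x]
    exact isSelfAdjoint_covDivB_unitary η hU₀u (isSelfAdjoint_liftBd i ha) x
  have h4 : projRPer τ ((PV d ℓ i.m i.K hd hL).sitesPerDir 0) (ℓ + 1) n η (torusLam (d := d + 1) n) U₀ (liftL i f₁) =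
      liftL i (RY i (parKnitY i) (GpY i (parKnitY i)) U f₁) := by
    have h := projRPer_eq_liftL_RY i hlev hG hU₀G hU₀per hpar hΔ hX hη τ hτ (liftL_isPeriodic i f₁) hfh
    rwa [descL_liftL] at h
  rw [h3, h4, descBd_covDerivFwd_liftL i hη hcf0 hU₀sh, hf₁, map_smul, map_smul, ← Complex.coe_smul, ← Complex.coe_smul, smul_smul, smul_smul]
  have hc : (((i.cf * η : ℝ)) : ℂ) ≠ 0 := Complex.ofReal_ne_zero.2 (mul_ne_zero hcf0 hη)
  have hone : (((i.cf * η) ^ 2 : ℝ) : ℂ) * ((((i.cf * η)⁻¹ : ℝ)) : ℂ) * (((i.cf * η : ℝ)) : ℂ)⁻¹ = 1 := by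
    rw [Complex.ofReal_pow, Complex.ofReal_inv]
    field_simp
  rw [hone, one_smul]

end LandauMatrix

/-! ## §3 The Hermitian junction closeness from its sectors -/

section Closeness

variable {𝔸 : Type} [CStarAlgebra 𝔸] [Nontrivial 𝔸] [FiniteDimensional ℝ 𝔸] (τ : 𝔸 →ₗ[ℂ] ℂ) (i : KIdx d ℓ hd hL b₀ b₁) {n : ℕ}

/-- ★★★ **THE HERMITIAN JUNCTION CLOSENESS FROM ITS SECTORS** (fibre-generic; the Landau identity displayed).  At a constant-level member (`levY ≡ n`,
`c_f = L^{n+1}`, period `P₀`), `U = bgY i U₀` for a periodic unitary `U₀ ∈ 𝔄_n(ℤ^{d+1}, α₀)`, `α₀ > 0`, `M ≥ 1`: IF def-Y's curvature part is small on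
Hermitian fields (`κ`), the Landau terms AGREE (identity `hLan`), and def-Y's averaging letter is `ε_Q`-close to the knit's `QQZdP` at the torus datum, THEN
`|Δ_a(U)a − (c_fη)²·(Δ_knit a♯)♭|₍₋₃₎ ≤ (κ + 14d·M·α₀ + ε_Q)|a|₍₋₁₎` for every Hermitian `a` — the `hE` of files 7c′ ∕ 8b.
[cite: Balaban1985BackgroundPropagators, (3.26) p.395, (3.10) p.392, (3.16) p.393, (3.69) p.404; Balaban1985RegularSpaces, (1.55)–(1.59) p.86, p.77 («Ω_j = T_η»)] -/
theorem closeness_herm_of_sectors (hL1 : 1 ≤ ℓ + 1) (hlev : ∀ z : SiteY i, levY i z = n) (hcf : i.cf = (((ℓ + 1 : ℕ) : ℝ)) ^ (n + 1))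
    {η : ℝ} (hη : 0 < η) {k : ℕ} (hk : 1 ≤ k) (ops₀ : ℝ → ZdIdx (d + 1) (ℓ + 1) → ℕ → OpsZd (d + 1) 𝔸) {M : ℝ} (hM : 1 ≤ M)
    (parS : SiteParY 𝔸 i) (parB : BondParY 𝔸 i) (Gp : SiteOpY 𝔸 i)
    {U₀ : LSite (d + 1) → Fin (d + 1) → 𝔸ˣ} (hU₀ : ∀ x κ, U₀ x κ ∈ unitaryUnits 𝔸)
    (hU₀per : IsPeriodic ((PV d ℓ i.m i.K hd hL).sitesPerDir 0) U₀) {α₀ : ℝ} (hα : 0 < α₀)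
    (hIn : InAk (ℓ + 1) n η α₀ (fun _ => (Set.univ : Set (LSite (d + 1)))) U₀) {κ εQ : ℝ}
    (hcurvY : ∀ a : FBondY i → 𝔸, (∀ b, IsSelfAdjoint (a b)) →
      wNormBY i (-3) (coCurlY i (bgY i U₀) (jordanY i (bgY i U₀) (curlY i (bgY i U₀) a) - curlY i (bgY i U₀) a) + curv2Y i (bgY i U₀) a) ≤
        κ * wNormBY i (-1) a)
    (hLan : ∀ a : FBondY i → 𝔸, (∀ b, IsSelfAdjoint (a b)) →
      ((i.cf * η) ^ 2 : ℝ) • descBd i (fun x μ => covDerivFwd η U₀ μ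
          (projRPer τ ((PV d ℓ i.m i.K hd hL).sitesPerDir 0) (ℓ + 1) n η (torusLam (d := d + 1) n) U₀ (covDivB η U₀ (liftBd i a))) x) =
        gradY i (bgY i U₀) (RY i parS Gp (bgY i U₀) (divY i (bgY i U₀) a)))
    (hQQ : ∀ a : FBondY i → 𝔸, (∀ b, IsSelfAdjoint (a b)) →
      wNormBY i (-3) (QsY i parB (bgY i U₀) (aY i (QY i parB (bgY i U₀) a)) - ((i.cf * η) ^ 2 : ℝ) •
          descBd i (QQZdP τ (ℓ + 1) (fun m => torusLamb (d := d + 1) m) (torusIdx (d := d + 1) hL1 ⟨η, hη, k, hk⟩) n U₀ (liftBd i a))) ≤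
        εQ * wNormBY i (-1) a)
    (a : FBondY i → 𝔸) (ha : ∀ b, IsSelfAdjoint (a b)) :
    wNormBY i (-3) (deltaAY i parS parB Gp (bgY i U₀) a - ((i.cf * η) ^ 2 : ℝ) •
        descBd i (deltaAOf η (opsAllZdPer τ (ℓ + 1) ((PV d ℓ i.m i.K hd hL).sitesPerDir 0) (fun m => torusLamb (d := d + 1) m) ops₀ M
          (torusIdx (d := d + 1) hL1 ⟨η, hη, k, hk⟩) n) U₀ (liftBd i a))) ≤
      (κ + 14 * d * M * α₀ + εQ) * wNormBY i (-1) a := by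
  set P₀ := (PV d ℓ i.m i.K hd hL).sitesPerDir 0 with hP₀
  set t : TorusMember := ⟨η, hη, k, hk⟩ with ht
  set U := bgY i U₀ with hU
  set cr : ℝ := (i.cf * η) ^ 2 with hcr
  have hη0 : η ≠ 0 := hη.ne'
  have hU₀sh : ∀ μ : Fin (d + 1), shiftCfg (((P₀ : ℕ) : ℤ) • e μ) U₀ = U₀ := fun μ => shiftCfg_eq_of_isPeriodic hU₀per μ
  -- the knit side, descended: four box fields
  set A := liftBd i a with hA
  have hK : descBd i (deltaAOf η (opsAllZdPer τ (ℓ + 1) P₀ (fun m => torusLamb (d := d + 1) m) ops₀ M (torusIdx (d := d + 1) hL1 t) n) U₀ A) =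
      descBd i (fun x μ => Jcur η U₀ A μ x) + descBd i (DpZd η U₀ A) +
        descBd i (fun x μ => covDerivFwd η U₀ μ (projRPer τ P₀ (ℓ + 1) n η (torusLam (d := d + 1) n) U₀ (covDivB η U₀ A)) x) +
        descBd i (QQZdP τ (ℓ + 1) (fun m => torusLamb (d := d + 1) m) (torusIdx (d := d + 1) hL1 t) n U₀ A) := by
    funext b
    rfl
  -- the def-Y side
  have hY : deltaAY i parS parB Gp U a = hessY i U a + gradY i U (RY i parS Gp U (divY i U a)) + QsY i parB U (aY i (QY i parB U a)) :=
    deltaAY_apply i parS parB Gp U a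
  have hcurv_eq : coCurlY i U (jordanY i U (curlY i U a) - curlY i U a) + curv2Y i U a = hessY i U a - coCurlY i U (curlY i U a) := by
    have hh : hessY i U a = coCurlY i U (jordanY i U (curlY i U a)) + curv2Y i U a := rfl
    rw [map_sub, hh]
    abel
  -- the two exact sectors
  have h1 : cr • descBd i (fun x μ => Jcur η U₀ A μ x) = coCurlY i U (curlY i U a) := smul_descBd_Jcur_eq i hη0 hU₀sh a
  have h3 := hLan a ha
  -- regrouping
  have hE : deltaAY i parS parB Gp U a - cr •
      descBd i (deltaAOf η (opsAllZdPer τ (ℓ + 1) P₀ (fun m => torusLamb (d := d + 1) m) ops₀ M (torusIdx (d := d + 1) hL1 t) n) U₀ A) =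
      (coCurlY i U (jordanY i U (curlY i U a) - curlY i U a) + curv2Y i U a) +
        (QsY i parB U (aY i (QY i parB U a)) -
          cr • descBd i (QQZdP τ (ℓ + 1) (fun m => torusLamb (d := d + 1) m) (torusIdx (d := d + 1) hL1 t) n U₀ A)) +
        -(cr • descBd i (DpZd η U₀ A)) := by
    rw [hK, smul_add, smul_add, smul_add, h1, h3, hY, hcurv_eq]
    abel
  rw [hE]
  refine (wNormBY_add_add_le i (-3) _ _ _).trans ?_
  have b1 := hcurvY a ha
  have b2 := hQQ a ha
  have b3 : wNormBY i (-3) (-(cr • descBd i (DpZd η U₀ A))) ≤ 14 * d * M * α₀ * wNormBY i (-1) a := by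
    rw [wNormBY_neg]
    exact wNormBY_smul_descBd_DpZd_le i τ hL1 hlev hcf hη hk ops₀ hM hU₀ hα hIn a
  calc _ ≤ κ * wNormBY i (-1) a + εQ * wNormBY i (-1) a + 14 * d * M * α₀ * wNormBY i (-1) a := add_le_add (add_le_add b1 b2) b3
    _ = (κ + 14 * d * M * α₀ + εQ) * wNormBY i (-1) a := by ring

end Closeness

/-! ## §3′ The closeness and the socket at the matrix fibre -/

section Matrix

open scoped Matrix Matrix.Norms.L2Operator

variable {N : ℕ} [NeZero N] (i : KIdx d ℓ hd hL b₀ b₁) {n : ℕ}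

/-- ★★★ **THE HERMITIAN JUNCTION CLOSENESS AT `M_N(ℂ)`**, Landau sector discharged (§2′): at def-Y's letters `(parKnitY, parB, GpY parKnitY)`, `τ = tr`, for a
periodic unitary `U₀ ∈ 𝔄_n(ℤ^{d+1}, α₀)` with unitary knit legs and `Δ′_a(U)`, `Q′G′²Q′*(U)` invertible: def-Y curvature smallness `κ` + averaging closeness
`ε_Q` ⟹ `|Δ_a(U)a − (c_fη)²·(Δ_knit a♯)♭|₍₋₃₎ ≤ (κ + 14d·M·α₀ + ε_Q)|a|₍₋₁₎` on Hermitian `a`.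
[cite: Balaban1985BackgroundPropagators, (3.26) p.395, (3.21)–(3.25) pp.394–395, (3.69) p.404; Balaban1985RegularSpaces, (1.58)–(1.59) p.86, p.77] -/
theorem closeness_herm_matrix (hL1 : 1 ≤ ℓ + 1) (hlev : ∀ z : SiteY i, levY i z = n) (hcf : i.cf = (((ℓ + 1 : ℕ) : ℝ)) ^ (n + 1))
    {η : ℝ} (hη : 0 < η) {k : ℕ} (hk : 1 ≤ k) (τ : Matrix (Fin N) (Fin N) ℂ →ₗ[ℂ] ℂ) (hτ : ∀ a, τ a = Matrix.trace a)
    (ops₀ : ℝ → ZdIdx (d + 1) (ℓ + 1) → ℕ →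
      (letI : CStarAlgebra (Matrix (Fin N) (Fin N) ℂ) := {}; OpsZd (d + 1) (Matrix (Fin N) (Fin N) ℂ)))
    {M : ℝ} (hM : 1 ≤ M) (parB : BondParY (Matrix (Fin N) (Fin N) ℂ) i)
    {U₀ : LSite (d + 1) → Fin (d + 1) → (Matrix (Fin N) (Fin N) ℂ)ˣ} (hU₀ : ∀ x κ, U₀ x κ ∈ B7Prop2Explicit.unitaryUnits (Matrix (Fin N) (Fin N) ℂ))
    (hU₀per : IsPeriodic ((PV d ℓ i.m i.K hd hL).sitesPerDir 0) U₀)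
    (hpar : ∀ z w : SiteY i, parKnitY i (bgY i U₀) z w ∈ B7Prop2Explicit.unitaryUnits (Matrix (Fin N) (Fin N) ℂ))
    (hΔ' : IsUnit (deltaPrimeAY i (parKnitY i) (bgY i U₀))) (hX : IsUnit (XY i (parKnitY i) (GpY i (parKnitY i)) (bgY i U₀)))
    {α₀ : ℝ} (hα : 0 < α₀) (hIn : InAk (ℓ + 1) n η α₀ (fun _ => (Set.univ : Set (LSite (d + 1)))) U₀) {κ εQ : ℝ}
    (hcurvY : ∀ a : FBondY i → Matrix (Fin N) (Fin N) ℂ, (∀ b, IsSelfAdjoint (a b)) →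
      wNormBY i (-3) (coCurlY i (bgY i U₀) (jordanY i (bgY i U₀) (curlY i (bgY i U₀) a) - curlY i (bgY i U₀) a) + curv2Y i (bgY i U₀) a) ≤
        κ * wNormBY i (-1) a)
    (hQQ : letI : CStarAlgebra (Matrix (Fin N) (Fin N) ℂ) := {}
      ∀ a : FBondY i → Matrix (Fin N) (Fin N) ℂ, (∀ b, IsSelfAdjoint (a b)) →
      wNormBY i (-3) (QsY i parB (bgY i U₀) (aY i (QY i parB (bgY i U₀) a)) - ((i.cf * η) ^ 2 : ℝ) •
          descBd i (QQZdP τ (ℓ + 1) (fun m => torusLamb (d := d + 1) m) (torusIdx (d := d + 1) hL1 ⟨η, hη, k, hk⟩) n U₀ (liftBd i a))) ≤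
        εQ * wNormBY i (-1) a)
    (a : FBondY i → Matrix (Fin N) (Fin N) ℂ) (ha : ∀ b, IsSelfAdjoint (a b)) :
    letI : CStarAlgebra (Matrix (Fin N) (Fin N) ℂ) := {}
    wNormBY i (-3) (deltaAY i (parKnitY i) parB (GpY i (parKnitY i)) (bgY i U₀) a - ((i.cf * η) ^ 2 : ℝ) •
        descBd i (deltaAOf η (opsAllZdPer τ (ℓ + 1) ((PV d ℓ i.m i.K hd hL).sitesPerDir 0) (fun m => torusLamb (d := d + 1) m) ops₀ M
          (torusIdx (d := d + 1) hL1 ⟨η, hη, k, hk⟩) n) U₀ (liftBd i a))) ≤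
      (κ + 14 * d * M * α₀ + εQ) * wNormBY i (-1) a := by
  letI : CStarAlgebra (Matrix (Fin N) (Fin N) ℂ) := {}
  refine closeness_herm_of_sectors τ i hL1 hlev hcf hη hk ops₀ hM (parKnitY i) parB (GpY i (parKnitY i)) hU₀ hU₀per hα hIn hcurvY
    (fun a' ha' => ?_) hQQ a ha
  exact landau_sector_exact i hlev hcf (G := B7Prop2Explicit.unitaryUnits (Matrix (Fin N) (Fin N) ℂ)) le_rfl hU₀ hU₀per hpar hΔ' hX hη.ne' τ hτ ha'

/-- ★★ **THE PER-BACKGROUND def-Y BINDER OF FILE 8b FROM THE SECTOR BINDER** at `M_N(ℂ)`: if for every `0 < α₀ ≤ a_T` and every periodic unitary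
`U₀ ∈ 𝔄_n(ℤ^{d+1}, α₀)`: `Δ_a(U)` is a unit with the three (3.47)₋₃ members at `B₀`, `Δ′_a(U)` and `Q′G′²Q′*(U)` are units, the knit legs are unitary, def-Y's
curvature part is `κ`-small and the averaging letters are `ε_Q`-close, THEN file 8b's binder `hY` holds with `ε = κ + 14d·M·a_T + ε_Q`.
[cite: Balaban1985BackgroundPropagators, (3.26) p.395, (3.69) p.404, Thm 3.3 p.399; Balaban1985RegularSpaces, (1.58)–(1.59) p.86, p.77] -/
theorem defY_binder_of_sectors (hL1 : 1 ≤ ℓ + 1)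
    (τ : Matrix (Fin N) (Fin N) ℂ →ₗ[ℂ] ℂ) (hτ : ∀ a, τ a = Matrix.trace a)
    (hlev : ∀ z : SiteY i, levY i z = n) (hcf : i.cf = (((ℓ + 1 : ℕ) : ℝ)) ^ (n + 1)) {η : ℝ} (hη : 0 < η) {k : ℕ} (hk : 1 ≤ k)
    (ops₀ : ℝ → ZdIdx (d + 1) (ℓ + 1) → ℕ →
      (letI : CStarAlgebra (Matrix (Fin N) (Fin N) ℂ) := {}; OpsZd (d + 1) (Matrix (Fin N) (Fin N) ℂ)))
    {M : ℝ} (hM1 : 1 ≤ M) (parB : BondParY (Matrix (Fin N) (Fin N) ℂ) i) {B₀ κ εQ aT : ℝ}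
    (hY : letI : CStarAlgebra (Matrix (Fin N) (Fin N) ℂ) := {}
      ∀ (α₀ : ℝ) (U₀ : LSite (d + 1) → Fin (d + 1) → (Matrix (Fin N) (Fin N) ℂ)ˣ),
      (∀ x κ, U₀ x κ ∈ B7Prop2Explicit.unitaryUnits (Matrix (Fin N) (Fin N) ℂ)) →
      IsPeriodic ((PV d ℓ i.m i.K hd hL).sitesPerDir 0) U₀ → 0 < α₀ → α₀ ≤ aT →
      InAk (ℓ + 1) n η α₀ (fun _ => (Set.univ : Set (LSite (d + 1)))) U₀ →
        IsUnit (deltaAY i (parKnitY i) parB (GpY i (parKnitY i)) (bgY i U₀)) ∧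
        (∀ F, wNormBY i (-1) (GAY i (parKnitY i) parB (GpY i (parKnitY i)) (bgY i U₀) F) ≤ B₀ * wNormBY i (-3) F) ∧
        (∀ F ν, wNormBY i (-2) (cdB i (bgY i U₀) ν (GAY i (parKnitY i) parB (GpY i (parKnitY i)) (bgY i U₀) F)) ≤ B₀ * wNormBY i (-3) F) ∧
        (∀ F, wNormBY i (-3) (lapB i (bgY i U₀) (GAY i (parKnitY i) parB (GpY i (parKnitY i)) (bgY i U₀) F)) ≤ B₀ * wNormBY i (-3) F) ∧
        IsUnit (deltaPrimeAY i (parKnitY i) (bgY i U₀)) ∧ IsUnit (XY i (parKnitY i) (GpY i (parKnitY i)) (bgY i U₀)) ∧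
        (∀ z w : SiteY i, parKnitY i (bgY i U₀) z w ∈ B7Prop2Explicit.unitaryUnits (Matrix (Fin N) (Fin N) ℂ)) ∧
        (∀ a : FBondY i → Matrix (Fin N) (Fin N) ℂ, (∀ b, IsSelfAdjoint (a b)) →
          wNormBY i (-3) (coCurlY i (bgY i U₀) (jordanY i (bgY i U₀) (curlY i (bgY i U₀) a) - curlY i (bgY i U₀) a) + curv2Y i (bgY i U₀) a) ≤
            κ * wNormBY i (-1) a) ∧
        (∀ a : FBondY i → Matrix (Fin N) (Fin N) ℂ, (∀ b, IsSelfAdjoint (a b)) →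
          wNormBY i (-3) (QsY i parB (bgY i U₀) (aY i (QY i parB (bgY i U₀) a)) - ((i.cf * η) ^ 2 : ℝ) •
              descBd i (QQZdP τ (ℓ + 1) (fun m => torusLamb (d := d + 1) m) (torusIdx (d := d + 1) hL1 ⟨η, hη, k, hk⟩) n U₀ (liftBd i a))) ≤
            εQ * wNormBY i (-1) a)) :
    letI : CStarAlgebra (Matrix (Fin N) (Fin N) ℂ) := {}
    ∀ (α₀ : ℝ) (U₀ : LSite (d + 1) → Fin (d + 1) → (Matrix (Fin N) (Fin N) ℂ)ˣ),
      (∀ x κ, U₀ x κ ∈ B7Prop2Explicit.unitaryUnits (Matrix (Fin N) (Fin N) ℂ)) →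
      IsPeriodic ((PV d ℓ i.m i.K hd hL).sitesPerDir 0) U₀ → 0 < α₀ → α₀ ≤ aT →
      InAk (ℓ + 1) n η α₀ (fun _ => (Set.univ : Set (LSite (d + 1)))) U₀ →
        IsUnit (deltaAY i (parKnitY i) parB (GpY i (parKnitY i)) (bgY i U₀)) ∧
        (∀ F, wNormBY i (-1) (GAY i (parKnitY i) parB (GpY i (parKnitY i)) (bgY i U₀) F) ≤ B₀ * wNormBY i (-3) F) ∧
        (∀ F ν, wNormBY i (-2) (cdB i (bgY i U₀) ν (GAY i (parKnitY i) parB (GpY i (parKnitY i)) (bgY i U₀) F)) ≤ B₀ * wNormBY i (-3) F) ∧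
        (∀ F, wNormBY i (-3) (lapB i (bgY i U₀) (GAY i (parKnitY i) parB (GpY i (parKnitY i)) (bgY i U₀) F)) ≤ B₀ * wNormBY i (-3) F) ∧
        (∀ a : FBondY i → Matrix (Fin N) (Fin N) ℂ, (∀ b, IsSelfAdjoint (a b)) →
          wNormBY i (-3) (deltaAY i (parKnitY i) parB (GpY i (parKnitY i)) (bgY i U₀) a - ((i.cf * η) ^ 2 : ℝ) •
            descBd i (deltaAOf η (opsAllZdPer τ (ℓ + 1) ((PV d ℓ i.m i.K hd hL).sitesPerDir 0) (fun m => torusLamb (d := d + 1) m) ops₀ M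
              (torusIdx (d := d + 1) hL1 ⟨η, hη, k, hk⟩) n) U₀ (liftBd i a))) ≤ (κ + 14 * d * M * aT + εQ) * wNormBY i (-1) a) := by
  letI : CStarAlgebra (Matrix (Fin N) (Fin N) ℂ) := {}
  intro α₀ U₀ hU₀ hper hα hαT hIn
  have hM0 : 0 ≤ M := zero_le_one.trans hM1
  obtain ⟨hΔ, hG0, hG1, hG3, hΔ', hX, hpar, hcurvY, hQQ⟩ := hY α₀ U₀ hU₀ hper hα hαT hIn
  refine ⟨hΔ, hG0, hG1, hG3, fun a ha => ?_⟩
  refine (closeness_herm_matrix i hL1 hlev hcf hη hk τ hτ ops₀ hM1 parB hU₀ hper hpar hΔ' hX hα hIn hcurvY hQQ a ha).trans ?_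
  refine mul_le_mul_of_nonneg_right ?_ (wNormBY_nonneg i _ a)
  have : 14 * (d : ℝ) * M * α₀ ≤ 14 * d * M * aT := mul_le_mul_of_nonneg_left hαT (by positivity)
  linarith

/-- ★★★ **[B8] (1.59) ON THE TORUS FROM def-Y's LETTERS MODULO (c′)** — file 8b's `sockB9P3Per_torusIdx_of_defY` at `M_N(ℂ)` with the per-background binder
now reading, for every `0 < α₀ ≤ a_T` and every periodic unitary `U₀ ∈ 𝔄_n(ℤ^{d+1}, α₀)`: `Δ_a(U)` invertible with the three (3.47)₋₃ members at `B₀`, `Δ′_a(U)` and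
`Q′G′²Q′*(U)` invertible, unitary knit legs, def-Y's curvature small (`κ`) and the AVERAGING CLOSENESS (`ε_Q`) — under `2(κ + 14d·M·a_T + ε_Q)B₀ ≤ 1`.
Conclusion (given the Hölder binder, as in file 8b): `SockB9P3Per P₀ L B₀′ B₀β′ c_P β len η n {ℤ^{d+1}} torusLam torusLamb` with file 8b's constants.
[cite: Balaban1985RegularSpaces, (1.58)–(1.59) p.86, Prop. 3 p.87, p.77 («Ω_j = T_η»); Balaban1985BackgroundPropagators, Thm 3.3 p.399, Thm 3.11 p.416, (3.26)–(3.27) p.395, (3.69) p.404] -/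
theorem sockB9P3Per_torusIdx_of_sectors (hd2 : 2 ≤ d + 1) (hL1 : 1 ≤ ℓ + 1)
    (τ : Matrix (Fin N) (Fin N) ℂ →ₗ[ℂ] ℂ) (hτ : ∀ a, τ a = Matrix.trace a) (hτt : ∀ a b, τ (a * b) = τ (b * a))
    {Cτ : ℝ} (hCτ : ∀ x y : Matrix (Fin N) (Fin N) ℂ, |(τ (star x * y)).re| ≤ Cτ * ‖x‖ * ‖y‖)
    (hlev : ∀ z : SiteY i, levY i z = n) (hcf : i.cf = (((ℓ + 1 : ℕ) : ℝ)) ^ (n + 1)) {η : ℝ} (hη : 0 < η) {k : ℕ} (hk : 1 ≤ k)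
    (hdvd : (ℓ + 1) ^ n ∣ (PV d ℓ i.m i.K hd hL).sitesPerDir 0)
    (ops₀ : ℝ → ZdIdx (d + 1) (ℓ + 1) → ℕ →
      (letI : CStarAlgebra (Matrix (Fin N) (Fin N) ℂ) := {}; OpsZd (d + 1) (Matrix (Fin N) (Fin N) ℂ)))
    {M : ℝ} (hM1 : 1 ≤ M) (parB : BondParY (Matrix (Fin N) (Fin N) ℂ) i) {B₀ κ εQ aT : ℝ} (hB₀ : 0 < B₀) (hκ : 0 ≤ κ) (hεQ : 0 ≤ εQ)
    (haT : 0 ≤ aT) (hεB : 2 * (κ + 14 * d * M * aT + εQ) * B₀ ≤ 1)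
    (hY : letI : CStarAlgebra (Matrix (Fin N) (Fin N) ℂ) := {}
      ∀ (α₀ : ℝ) (U₀ : LSite (d + 1) → Fin (d + 1) → (Matrix (Fin N) (Fin N) ℂ)ˣ),
      (∀ x κ, U₀ x κ ∈ B7Prop2Explicit.unitaryUnits (Matrix (Fin N) (Fin N) ℂ)) →
      IsPeriodic ((PV d ℓ i.m i.K hd hL).sitesPerDir 0) U₀ → 0 < α₀ → α₀ ≤ aT →
      InAk (ℓ + 1) n η α₀ (fun _ => (Set.univ : Set (LSite (d + 1)))) U₀ →
        IsUnit (deltaAY i (parKnitY i) parB (GpY i (parKnitY i)) (bgY i U₀)) ∧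
        (∀ F, wNormBY i (-1) (GAY i (parKnitY i) parB (GpY i (parKnitY i)) (bgY i U₀) F) ≤ B₀ * wNormBY i (-3) F) ∧
        (∀ F ν, wNormBY i (-2) (cdB i (bgY i U₀) ν (GAY i (parKnitY i) parB (GpY i (parKnitY i)) (bgY i U₀) F)) ≤ B₀ * wNormBY i (-3) F) ∧
        (∀ F, wNormBY i (-3) (lapB i (bgY i U₀) (GAY i (parKnitY i) parB (GpY i (parKnitY i)) (bgY i U₀) F)) ≤ B₀ * wNormBY i (-3) F) ∧
        IsUnit (deltaPrimeAY i (parKnitY i) (bgY i U₀)) ∧ IsUnit (XY i (parKnitY i) (GpY i (parKnitY i)) (bgY i U₀)) ∧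
        (∀ z w : SiteY i, parKnitY i (bgY i U₀) z w ∈ B7Prop2Explicit.unitaryUnits (Matrix (Fin N) (Fin N) ℂ)) ∧
        (∀ a : FBondY i → Matrix (Fin N) (Fin N) ℂ, (∀ b, IsSelfAdjoint (a b)) →
          wNormBY i (-3) (coCurlY i (bgY i U₀) (jordanY i (bgY i U₀) (curlY i (bgY i U₀) a) - curlY i (bgY i U₀) a) + curv2Y i (bgY i U₀) a) ≤
            κ * wNormBY i (-1) a) ∧
        (∀ a : FBondY i → Matrix (Fin N) (Fin N) ℂ, (∀ b, IsSelfAdjoint (a b)) →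
          wNormBY i (-3) (QsY i parB (bgY i U₀) (aY i (QY i parB (bgY i U₀) a)) - ((i.cf * η) ^ 2 : ℝ) •
              descBd i (QQZdP τ (ℓ + 1) (fun m => torusLamb (d := d + 1) m) (torusIdx (d := d + 1) hL1 ⟨η, hη, k, hk⟩) n U₀ (liftBd i a))) ≤
            εQ * wNormBY i (-1) a))
    {Cβ β : ℝ} {len : LSite (d + 1) → ℝ}
    (hhol : letI : CStarAlgebra (Matrix (Fin N) (Fin N) ℂ) := {}
      B9SupplySockB9P3ZdPer.HolderAtIPer ((PV d ℓ i.m i.K hd hL).sitesPerDir 0) (ℓ + 1)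
        (opsAllZdPer τ (ℓ + 1) ((PV d ℓ i.m i.K hd hL).sitesPerDir 0) (fun m => torusLamb (d := d + 1) m) ops₀) aT Cβ β len M
        (torusIdx (d := d + 1) hL1 ⟨η, hη, k, hk⟩) n) :
    letI : CStarAlgebra (Matrix (Fin N) (Fin N) ℂ) := {}
    SockB9P3Per (𝔸 := Matrix (Fin N) (Fin N) ℂ) ((PV d ℓ i.m i.K hd hL).sitesPerDir 0) (ℓ + 1)
      (max 1 (2 * (2 * B₀) * max 1 (qQ (d + 1) (ℓ + 1) Cτ (betaTau τ) 0)))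
      (2 * max 0 Cβ * max 1 (qQ (d + 1) (ℓ + 1) Cτ (betaTau τ) 0))
      (min (1 / 16) (min aT (min aT (1 / (2 * (2 * B₀) * (14 * ((d + 1 - 1 : ℕ) : ℝ)) * M + 1)))))
      β len η n (fun _ => (Set.univ : Set (LSite (d + 1)))) (fun m => torusLam (d := d + 1) m) (fun m => torusLamb (d := d + 1) m) := by
  letI : CStarAlgebra (Matrix (Fin N) (Fin N) ℂ) := {}
  have hτs : ∀ a : Matrix (Fin N) (Fin N) ℂ, τ (star a) = starRingEnd ℂ (τ a) := B9B8KnitLandauProjection.trace_hermitian τ hτ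
  have hτp : ∀ a : Matrix (Fin N) (Fin N) ℂ, a ≠ 0 → 0 < (τ (star a * a)).re := B9B8KnitLandauProjection.trace_faithful τ hτ
  have hM0 : 0 ≤ M := zero_le_one.trans hM1
  have hε : 0 ≤ κ + 14 * d * M * aT + εQ := by positivity
  exact sockB9P3Per_torusIdx_of_defY τ i hd2 hL1 hτp hτt hτs hCτ hlev hcf hη hk hdvd ops₀ hM1 (parKnitY i) parB (GpY i (parKnitY i)) hB₀ hε hεB
    (defY_binder_of_sectors i hL1 τ hτ hlev hcf hη hk ops₀ hM1 parB hY) hhol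

end Matrix

end Literature.MathematicalPhysics.QuantumFieldTheory.Balaban1983to89.B9B8KnitClosenessOfSectors
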